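import Summits.ResolutionOfSingularities.ResolutionOfSingularities.Theorems.FrobeniusClosingPatchingRelPerfectMonomialPairPrincipalization
import Summits.ResolutionOfSingularities.ResolutionOfSingularities.Theorems.FrobeniusClosingPatchingRelPerfectTowerContraction
import HarnessLib

/-!
# Crux `PatchingRelPerfect` (stmt-ResolutionOfSingularities-16161), chain w52 — R4 support:
# PRINCIPALIZATION OF A PAIR OF MONOMIAL IDEALS, part 4 (contraction to the companion format)

[OURS · L1 W5.2 · R4 support «monomial cleanup»] The monomial cleanup of parts 1–3
(`MonomialCleanup.exists_centreSeq_principalize`) composed with the chain's contraction D5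
(`towerContraction`, p493249; Stacks 080A/080B): if, along a blowing up `g : X → Spec S` cosupported
in the closed point of the regular local ring `S`, the ideal `I ≠ 0` has the FORMAT
`I𝒪_X = M · (monomialIdeal A ⊔ monomialIdeal B)` with `M` locally principal, `A`, `B` exponent lists on
a simple normal crossings boundary of `X` and the cosupport of `monomialIdeal A ⊔ monomialIdeal B` over
the closed point, then `I` is in the companion class `𝒞`: some `Bl_{I·Q} S`, `Q ⊇ 𝔪^m`, is regular
(`companion_of_monomialPair`), whence the core's conclusion for every blowing up along `I`
(`atomConclusion_of_monomialPair`).  PROVED, with the iteration of Stacks 080B along a `CentreSeq`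
(`centreSeq_exists_isBlowup_comp_supported`: a multiple blow-up with centres over `T` after a blowing
up cosupported in `T` is a blowing up cosupported in `T`, over a Noetherian base).  Any dimension of
`S`; no characteristic / residue field / excellence hypothesis.  FORMAT evidence for the core in the
sense of CHAIN §1 (A); nothing here is a statement of the manuscript under review.

## References

* The Stacks Project, Tags 080A, 080B. [StacksProject]
* J. Kollár, *Lectures on Resolution of Singularities* (2007), (3.111) Step 3. [Kollar2007]
-/

-- `Summit.<Summit>.<Sub>.Theorems` with `Sub = Summit` (single-conjunct summit, D-0017)
set_option linter.dupNamespace false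

noncomputable section

open CategoryTheory AlgebraicGeometry TopologicalSpace IsLocalRing
open Literature.AlgebraicGeometry.Resolution

namespace Summit.ResolutionOfSingularities.ResolutionOfSingularities.Theorems

namespace MonomialCleanup

universe u

/-- **Stacks 080B along a multiple blow-up**: if `g : X → Y` (with `Y` Noetherian) is a blowing up
along an ideal sheaf cosupported in `T ⊆ Y` and `s` is a multiple blow-up of `X` whose centres lie over
`T`, then `s.comp ≫ g` is a blowing up along an ideal sheaf cosupported in `T`.
[cite: StacksProject, Tag 080B] -/
theorem centreSeq_exists_isBlowup_comp_supported {Y : Scheme.{u}} [IsNoetherian Y] :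
    ∀ {X : Scheme.{u}} (s : CentreSeq X) (g : X ⟶ Y) (T : Set Y),
      (∃ P : Y.IdealSheafData, IsBlowup g P ∧ (P.support : Set Y) ⊆ T) →
      s.CentresOver (g ⁻¹' T) →
      ∃ Q : Y.IdealSheafData, IsBlowup (s.comp ≫ g) Q ∧ (Q.support : Set Y) ⊆ T
  | X, CentreSeq.nil _, g, T, ⟨P, hP, hPT⟩, _ => by
    refine ⟨P, ?_, hPT⟩
    show IsBlowup (𝟙 X ≫ g) P
    rw [Category.id_comp]
    exact hP
  | X, CentreSeq.cons C rest, g, T, ⟨P, hP, hPT⟩, hover => by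
    obtain ⟨hC, hrest⟩ := (CentreSeq.centresOver_cons C rest _).mp hover
    obtain ⟨Q₁, hQ₁, hQ₁T⟩ :=
      hP.exists_isBlowup_comp_supported g P (blowup.π C) C T hPT (blowup.isBlowup C) hC
    have hpre : (⇑(blowup.π C ≫ g) ⁻¹' T : Set (blowup C)) = ⇑(blowup.π C) ⁻¹' (⇑g ⁻¹' T) := by
      ext x
      simp only [Set.mem_preimage, Scheme.Hom.comp_apply]
    obtain ⟨Q, hQ, hQT⟩ := centreSeq_exists_isBlowup_comp_supported rest (blowup.π C ≫ g) T
      ⟨Q₁, hQ₁, hQ₁T⟩ (by rw [hpre]; exact hrest)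
    refine ⟨Q, ?_, hQT⟩
    show IsBlowup ((rest.comp ≫ blowup.π C) ≫ g) Q
    rw [Category.assoc]
    exact hQ

/-- **Monomial cleanup in the companion format.** `S` regular local, `I ≠ 0`; `g : X → Spec S` a
blowing up cosupported in the closed point, `X` Noetherian; `I𝒪_X = M · (monomialIdeal A ⊔
monomialIdeal B)` with `M` locally principal and `A`, `B` exponent lists on a simple normal crossings
boundary of `X` (so `X` is regular), the cosupport of `monomialIdeal A ⊔ monomialIdeal B` lying over the
closed point.  Then some `Bl_{I·Q} S` with `Q ⊇ 𝔪^m` is regular.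
[cite: StacksProject, Tag 080A] [cite: Kollar2007, (3.111) Step 3] -/
theorem companion_of_monomialPair {S : Type u} [CommRing S] [IsRegularLocalRing S] {I : Ideal S}
    (hI : I ≠ ⊥) {X : Scheme.{u}} [IsNoetherian X] {g : X ⟶ Spec (.of S)}
    {K₀ : (Spec (.of S)).IdealSheafData} (hg : IsBlowup g K₀)
    (hK₀ : (K₀.support : Set (Spec (.of S))) ⊆ {IsLocalRing.closedPoint S})
    {A B : List (X.IdealSheafData × ℕ)} (hAB : boundaryOf A = boundaryOf B) (hE : HasSNC (boundaryOf A))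
    {M : X.IdealSheafData} (hM : IsLocallyPrincipal M)
    (hfmt : (affineBlowup.idealSheaf I).comap g = M * (monomialIdeal A ⊔ monomialIdeal B))
    (hsupp : ((monomialIdeal A ⊔ monomialIdeal B).support : Set X) ⊆ g ⁻¹' {IsLocalRing.closedPoint S}) :
    ∃ (Q : Ideal S) (m : ℕ), IsLocalRing.maximalIdeal S ^ m ≤ Q ∧
      ∃ (B' : Scheme.{u}) (b : B' ⟶ Spec (.of S)),
        IsBlowup b (affineBlowup.idealSheaf (I * Q)) ∧ Scheme.IsRegular B' := by
  obtain ⟨s, -, hover, hreg, hlp⟩ := exists_centreSeq_isLocallyPrincipal_comap A B hAB hE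
  obtain ⟨Q, hQ, hQT⟩ := centreSeq_exists_isBlowup_comp_supported s g {IsLocalRing.closedPoint S}
    ⟨K₀, hg, hK₀⟩ (CentreSeq.CentresOver.mono s hsupp hover)
  refine towerContraction I hI s.top (s.comp ≫ g) Q hQ hQT hreg ?_
  rw [Scheme.IdealSheafData.comap_comp, hfmt, comap_mul]
  exact (hM.comap s.comp).mul hlp

/-- **The core's conclusion for ideals cleaned up to a monomial pair**: under the hypotheses of
`companion_of_monomialPair`, every blowing up `T → Spec S` along `I` carries a non-zero ideal sheaf
cosupported in the closed fibre whose blowing up is regular (shape of the registered core stub /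
`DepthOneConclusion`). [cite: StacksProject, Tag 080A] -/
theorem atomConclusion_of_monomialPair {S : Type u} [CommRing S] [IsRegularLocalRing S] {I : Ideal S}
    (hI : I ≠ ⊥) {X : Scheme.{u}} [IsNoetherian X] {g : X ⟶ Spec (.of S)}
    {K₀ : (Spec (.of S)).IdealSheafData} (hg : IsBlowup g K₀)
    (hK₀ : (K₀.support : Set (Spec (.of S))) ⊆ {IsLocalRing.closedPoint S})
    {A B : List (X.IdealSheafData × ℕ)} (hAB : boundaryOf A = boundaryOf B) (hE : HasSNC (boundaryOf A))
    {M : X.IdealSheafData} (hM : IsLocallyPrincipal M)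
    (hfmt : (affineBlowup.idealSheaf I).comap g = M * (monomialIdeal A ⊔ monomialIdeal B))
    (hsupp : ((monomialIdeal A ⊔ monomialIdeal B).support : Set X) ⊆ g ⁻¹' {IsLocalRing.closedPoint S})
    (T : Scheme.{u}) (f : T ⟶ Spec (.of S)) (hf : IsBlowup f (affineBlowup.idealSheaf I)) :
    ∃ (J : T.IdealSheafData) (T' : Scheme.{u}) (π : T' ⟶ T), J ≠ ⊥ ∧
      (∀ t : T, t ∈ J.support → f.base t = IsLocalRing.closedPoint S) ∧
      IsBlowup π J ∧ Scheme.IsRegular T' := by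
  obtain ⟨s, -, hover, hreg, hlp⟩ := exists_centreSeq_isLocallyPrincipal_comap A B hAB hE
  obtain ⟨Q, hQ, hQT⟩ := centreSeq_exists_isBlowup_comp_supported s g {IsLocalRing.closedPoint S}
    ⟨K₀, hg, hK₀⟩ (CentreSeq.CentresOver.mono s hsupp hover)
  refine atomConclusion_of_tower hI hQ hQT hreg ?_ T f hf
  rw [Scheme.IdealSheafData.comap_comp, hfmt, comap_mul]
  exact (hM.comap s.comp).mul hlp

end MonomialCleanup

end Summit.ResolutionOfSingularities.ResolutionOfSingularities.Theorems

end
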